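import Literature.NumberTheory.Automorphic.UnitaryGroupCohomologicalForms
import Mathlib.RepresentationTheory.Irreducible
import Mathlib.MeasureTheory.Function.LpSpace.ContinuousFunctions
import HarnessLib

/-!
# FLOOR-0 junction T7 (programmes P3 «U3-mult» / P2): cotangent automorphic forms read in the honest `L²` spectrum —
# the `toQuotFun` calculus, `ContainsForm`, and «equivariant form-valued maps give a finite component» (J1 / J2 / J3), GENERIC part

Cell hodgecm-mathlib, FLOOR 0; crux item H413 = stmt-HodgeConjecture-24833 (route `HCCMUnconditional`); prover F0P3-p04 (g0),
share «junction T7 support» of the JOIN BRIEF of line `Cruxes/H413/Lines/F0_U3CohMultOne.lean` (F0P3-plan (g0)) and of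
F0P2-plan (g0)'s PLAN §5 (J1–J3).  PROOF FILE: theorems only — no definition, no instance, no notation, no named fact, no
`sorry`; imports = ★ tree + Mathlib.  HONEST LABEL: HC_CM is proved only modulo the printed citations until rung 0 closes.
The PIN specialisation (crux carriers `adelicDatum F V`, `rightRep F V`, `holCotForms / cohForms 𝔞`) is the sibling file
`Theorems/H413SpectrumJunctionPin.lean` (§4).

CURRENCY = the generic Literature carriers (A) ★ `Literature/NumberTheory/Automorphic/UnitaryGroupCohomologicalForms.lean`
(`CotangentForms.toQuotFun`, `DiscreteAutomorphicRep.ContainsForm / IsHolCotangentAt / IsAntiholCotangentAt / finRep /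
HasFinComponent`) over the tree's honest `L²` spectrum ★ `AutomorphicSpectrum` (`AdelicGroupData.L2`, `rightRegular`,
`DiscreteAutomorphicRep`).

WHAT IS PROVED (everything folklore / bookkeeping; the cite tags are provenance):
* §1 the `toQuotFun` calculus for ANY adelic group datum `𝒢` ([BorelJacquet1979, §4.2, §4.6]): a left-`A_G·G(K)`-invariant
  function `Φ` on `G(𝔸_K)` read on the automorphic quotient `[g] ↦ Φ(g⁻¹)` is linear in `Φ`, CONTINUOUS when `Φ` is, hence
  `MemLp p` for every `p` on a compact quotient with finite measure, its `L²`-class is non-zero when `Φ ≠ 0` (measure positive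
  on open sets), and the TRANSPORT identity `[x ↦ Φ(x h)] = R(h) [Φ]` for the tree's regular representation
  `(R h f)(x) = f(h⁻¹ • x)` — right translation of forms IS the regular representation on classes;
* §2 `P.ContainsForm Φ` unfolded against given `MemLp` witnesses, and from/to any `L²`-classes with continuous representatives
  descending `Φ` (the shape of programme P2's `Represents`, spelled without that token);
* §3 (J3) `hasFinComponent_of_equivariant`: for the unitary datum `U(J)`, an irreducible `σ` of `U(J)(𝔸_{F,f})` and a
  NON-ZERO `U(J)(𝔸_{F,f})`-equivariant linear `ψ : σ → (U(J)(𝔸_F) → ℂ²)` whose values are left-`U(J)(F)`-invariant with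
  continuous coordinates and contained in the discrete automorphic `P` (`ContainsForm`), the coordinate-class map is an
  INJECTIVE intertwiner `σ → P|_{U(J)(𝔸_{F,f})}`, i.e. `P.HasFinComponent σ` (Schur: a non-zero intertwiner out of an
  irreducible is injective, Mathlib `Representation.IsIrreducible.injective_or_eq_zero`); and (J2-shape) the `∃`-introductions
  of `IsHolCotangentAt` / `IsAntiholCotangentAt` from a non-zero (anti)holomorphic-valued such `ψ`.

CONTINUITY CAVEAT (read before folding).  ★ `weightForms` is purely algebraic, so `holCotForms` carries NO continuity conjunct;
the `L²` statements therefore take `Continuous (fun x => Φ x j)` on `U(J)(𝔸_F)` as a hypothesis.  At the pin it is supplied by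
programme P2's stub U2ℓ (`Represents`: continuous descents) through `continuous_of_continuous_descent` below.

## References
* [BorelJacquet1979] A. Borel, H. Jacquet, *Automorphic forms and automorphic representations*, PSPM 33.1 (1979), §4.2 (left
  `G(K)`-invariance, right translation), §4.6 (the discrete spectrum; `π ≅ π_∞ ⊗ π_f`, finite components).
* [GelfandGraevPiatetskiShapiro1969] I. M. Gelfand, M. I. Graev, I. I. Piatetski-Shapiro, *Representation theory and automorphic functions*
  (1969), Ch. 1 §2.3 (functions on a compact quotient in `L²`, right translation).
* [BorelWallach2000] A. Borel, N. Wallach, *Continuous cohomology, discrete subgroups, and representations of reductive groups*,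
  2nd ed. (2000), VII 3.2 (harmonic forms inside `L²(Γ\G)`).
-/

set_option autoImplicit false

-- the mandated namespace has the single-problem summit's repeated segment (`HodgeConjecture.HodgeConjecture`)
set_option linter.dupNamespace false

noncomputable section

namespace Summit.HodgeConjecture.HodgeConjecture.Cruxes.H413.SpectrumJunction

open MeasureTheory NumberField Topology
open scoped ENNReal
open Literature.NumberTheory.Automorphic Literature.NumberTheory.Automorphic.UnitaryGroup
open Literature.NumberTheory.Automorphic.UnitaryGroup.CotangentForms (toQuotFun toQuotFun_mk mem_holCotForms_iff)

/-! ## §1 The `toQuotFun` calculus on an arbitrary adelic group datum -/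

section ToQuotFun

variable {K : Type} [Field K] [NumberField K] {𝒢 : AdelicGroupData.{0} K}

/-- `toQuotFun` is additive in the function (pointwise). [cite: BorelJacquet1979, §4.2] -/
theorem toQuotFun_add (Φ Ψ : 𝒢.Adelic → ℂ) : toQuotFun 𝒢 (Φ + Ψ) = toQuotFun 𝒢 Φ + toQuotFun 𝒢 Ψ := rfl

/-- `toQuotFun` commutes with scalars (pointwise). [cite: BorelJacquet1979, §4.2] -/
theorem toQuotFun_smul (c : ℂ) (Φ : 𝒢.Adelic → ℂ) : toQuotFun 𝒢 (c • Φ) = c • toQuotFun 𝒢 Φ := rfl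

/-- `toQuotFun 0 = 0`. [cite: BorelJacquet1979, §4.2] -/
theorem toQuotFun_zero : toQuotFun 𝒢 (0 : 𝒢.Adelic → ℂ) = 0 := rfl

/-- The left action of `G(𝔸_K)` on the automorphic quotient on representatives: `a • [g] = [a g]` (`rfl`).
[cite: BorelJacquet1979, §4.2] -/
theorem smul_toAutomorphicQuotient (a g : 𝒢.Adelic) :
    a • 𝒢.toAutomorphicQuotient g = 𝒢.toAutomorphicQuotient (a * g) := rfl

/-- Every point of the automorphic quotient is a class `[g]`. [cite: BorelJacquet1979, §4.2] -/
theorem toAutomorphicQuotient_surjective : Function.Surjective 𝒢.toAutomorphicQuotient :=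
  QuotientGroup.mk_surjective

/-- For `Φ` left-invariant under `A_G · G(K)`: `toQuotFun Φ ∘ [·] = Φ(·⁻¹)`. [cite: BorelJacquet1979, §4.2] -/
theorem toQuotFun_comp_toAutomorphicQuotient {Φ : 𝒢.Adelic → ℂ}
    (hΦ : ∀ γ ∈ 𝒢.quotientSubgroup, ∀ g, Φ (γ * g) = Φ g) :
    toQuotFun 𝒢 Φ ∘ 𝒢.toAutomorphicQuotient = fun g => Φ g⁻¹ :=
  funext fun g => toQuotFun_mk hΦ g

/-- A left-invariant `Φ` is recovered from its descent: `Φ g = toQuotFun Φ [g⁻¹]`. [cite: BorelJacquet1979, §4.2] -/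
theorem apply_eq_toQuotFun {Φ : 𝒢.Adelic → ℂ} (hΦ : ∀ γ ∈ 𝒢.quotientSubgroup, ∀ g, Φ (γ * g) = Φ g) (g : 𝒢.Adelic) :
    Φ g = toQuotFun 𝒢 Φ (𝒢.toAutomorphicQuotient g⁻¹) := by
  rw [toQuotFun_mk hΦ g⁻¹, inv_inv]

/-- Left-invariance is inherited by right translates: `x ↦ Φ (x h)` is again left-`A_G · G(K)`-invariant.
[cite: BorelJacquet1979, §4.2] -/
theorem leftInvariant_mul_right {Φ : 𝒢.Adelic → ℂ} (hΦ : ∀ γ ∈ 𝒢.quotientSubgroup, ∀ g, Φ (γ * g) = Φ g)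
    (h : 𝒢.Adelic) : ∀ γ ∈ 𝒢.quotientSubgroup, ∀ g, (fun x => Φ (x * h)) (γ * g) = (fun x => Φ (x * h)) g :=
  fun γ hγ g => by simp only [mul_assoc, hΦ γ hγ (g * h)]

/-- **Right translation is left translation on the quotient**: for left-invariant `Φ`,
`toQuotFun (x ↦ Φ (x h)) y = toQuotFun Φ (h⁻¹ • y)`. [cite: BorelJacquet1979, §4.2] -/
theorem toQuotFun_mul_right_apply {Φ : 𝒢.Adelic → ℂ} (hΦ : ∀ γ ∈ 𝒢.quotientSubgroup, ∀ g, Φ (γ * g) = Φ g)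
    (h : 𝒢.Adelic) (y : 𝒢.automorphicQuotient) :
    toQuotFun 𝒢 (fun x => Φ (x * h)) y = toQuotFun 𝒢 Φ (h⁻¹ • y) := by
  obtain ⟨g, rfl⟩ := toAutomorphicQuotient_surjective y
  rw [toQuotFun_mk (leftInvariant_mul_right hΦ h) g, smul_toAutomorphicQuotient, toQuotFun_mk hΦ (h⁻¹ * g),
    mul_inv_rev, inv_inv]

/-- **Continuity of the descent**: a CONTINUOUS left-`A_G · G(K)`-invariant function on `G(𝔸_K)` read on the automorphic
quotient is continuous (lift along the quotient map). [cite: BorelJacquet1979, §4.2] -/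
theorem continuous_toQuotFun {Φ : 𝒢.Adelic → ℂ} (hΦ : ∀ γ ∈ 𝒢.quotientSubgroup, ∀ g, Φ (γ * g) = Φ g)
    (hc : Continuous Φ) : Continuous (toQuotFun 𝒢 Φ) := by
  have hq : IsQuotientMap 𝒢.toAutomorphicQuotient := QuotientGroup.isQuotientMap_mk 𝒢.quotientSubgroup
  rw [hq.continuous_iff, toQuotFun_comp_toAutomorphicQuotient hΦ]
  exact hc.comp continuous_inv

/-- Conversely, a function with a continuous left-invariant-style descent is continuous: if `φ` is continuous on the
automorphic quotient and `φ [h] = Φ (h⁻¹)` for all `h`, then `Φ` is continuous on `G(𝔸_K)` (the shape in which programme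
P2's `Represents` delivers continuity of cotangent forms). [cite: BorelJacquet1979, §4.2] -/
theorem continuous_of_continuous_descent {Φ : 𝒢.Adelic → ℂ} (φ : C(𝒢.automorphicQuotient, ℂ))
    (hφ : ∀ h, φ (𝒢.toAutomorphicQuotient h) = Φ h⁻¹) : Continuous Φ := by
  have hΦ : Φ = fun h => φ (𝒢.toAutomorphicQuotient h⁻¹) := funext fun h => by rw [hφ, inv_inv]
  rw [hΦ]
  exact φ.continuous.comp (𝒢.continuous_toAutomorphicQuotient.comp continuous_inv)

/-- A continuous descent IS `toQuotFun`: if `φ [h] = Φ (h⁻¹)` for all `h` then `φ = toQuotFun Φ` (for left-invariant `Φ`).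
[cite: BorelJacquet1979, §4.2] -/
theorem descent_eq_toQuotFun {Φ : 𝒢.Adelic → ℂ} (hΦ : ∀ γ ∈ 𝒢.quotientSubgroup, ∀ g, Φ (γ * g) = Φ g)
    (φ : 𝒢.automorphicQuotient → ℂ) (hφ : ∀ h, φ (𝒢.toAutomorphicQuotient h) = Φ h⁻¹) : φ = toQuotFun 𝒢 Φ := by
  funext y
  obtain ⟨g, rfl⟩ := toAutomorphicQuotient_surjective y
  rw [hφ, toQuotFun_mk hΦ]

variable {μ : Measure 𝒢.automorphicQuotient}

/-- **`L^p` on a compact quotient**: a continuous left-invariant `Φ` read on a COMPACT automorphic quotient with a finite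
measure is in `L^p` for every `p` (bounded continuous functions are in `L^∞ ⊆ L^p`). [cite: GelfandGraevPiatetskiShapiro1969, Ch. 1 §2.3] -/
theorem memLp_toQuotFun [CompactSpace 𝒢.automorphicQuotient] [IsFiniteMeasure μ] {Φ : 𝒢.Adelic → ℂ}
    (hΦ : ∀ γ ∈ 𝒢.quotientSubgroup, ∀ g, Φ (γ * g) = Φ g) (hc : Continuous Φ) (p : ℝ≥0∞) :
    MemLp (toQuotFun 𝒢 Φ) p μ := by
  have h := (BoundedContinuousFunction.mkOfCompact ⟨toQuotFun 𝒢 Φ, continuous_toQuotFun hΦ hc⟩).memLp_top (μ := μ)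
  exact h.mono_exponent le_top

/-- **Non-vanishing of the class**: for a measure positive on open sets, the `L^p`-class of the descent of a continuous
left-invariant `Φ ≠ 0` is non-zero (two continuous functions agreeing a.e. agree). [cite: BorelJacquet1979, §4.6] -/
theorem toLp_toQuotFun_ne_zero [μ.IsOpenPosMeasure] {Φ : 𝒢.Adelic → ℂ}
    (hΦ : ∀ γ ∈ 𝒢.quotientSubgroup, ∀ g, Φ (γ * g) = Φ g) (hc : Continuous Φ) {p : ℝ≥0∞}
    (hmem : MemLp (toQuotFun 𝒢 Φ) p μ) (hne : Φ ≠ 0) : hmem.toLp (toQuotFun 𝒢 Φ) ≠ 0 := by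
  intro h0
  apply hne
  have h1 : toQuotFun 𝒢 Φ =ᵐ[μ] (0 : 𝒢.automorphicQuotient → ℂ) := by
    have h2 := hmem.coeFn_toLp
    rw [h0] at h2
    exact h2.symm.trans (Lp.coeFn_zero ℂ p μ)
  have h3 : toQuotFun 𝒢 Φ = 0 :=
    (Continuous.ae_eq_iff_eq μ (continuous_toQuotFun hΦ hc) continuous_zero).mp h1
  funext g
  rw [apply_eq_toQuotFun hΦ g, h3]
  rfl

/-- **TRANSPORT (junction (i)): right translation of forms is the regular representation on classes.**  For a
left-invariant `Φ` with `toQuotFun Φ ∈ L²` and `h ∈ G(𝔸_K)`: the class of `x ↦ Φ (x h)` is `R(h)` applied to the class of `Φ`,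
`R` the tree's regular representation `(R h f)(y) = f (h⁻¹ • y)` (★ `rightRegular_apply_coeFn`). [cite: BorelJacquet1979, §4.6]
[cite: GelfandGraevPiatetskiShapiro1969, Ch. 1 §2.3] -/
theorem toLp_toQuotFun_mul_right [SMulInvariantMeasure 𝒢.Adelic 𝒢.automorphicQuotient μ] {Φ : 𝒢.Adelic → ℂ}
    (hΦ : ∀ γ ∈ 𝒢.quotientSubgroup, ∀ g, Φ (γ * g) = Φ g) (h : 𝒢.Adelic)
    (hmem : MemLp (toQuotFun 𝒢 Φ) 2 μ) (hmemh : MemLp (toQuotFun 𝒢 fun x => Φ (x * h)) 2 μ) :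
    hmemh.toLp (toQuotFun 𝒢 fun x => Φ (x * h)) = 𝒢.rightRegular μ h (hmem.toLp (toQuotFun 𝒢 Φ)) := by
  apply Lp.ext
  have h1 := hmemh.coeFn_toLp
  have h2 := 𝒢.rightRegular_apply_coeFn μ h (hmem.toLp (toQuotFun 𝒢 Φ))
  have h3 : (fun y => (hmem.toLp (toQuotFun 𝒢 Φ) : 𝒢.automorphicQuotient → ℂ) (h⁻¹ • y)) =ᵐ[μ]
      fun y => toQuotFun 𝒢 Φ (h⁻¹ • y) :=
    (measurePreserving_smul h⁻¹ μ).quasiMeasurePreserving.ae_eq_comp hmem.coeFn_toLp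
  refine h1.trans (Filter.EventuallyEq.trans ?_ (h2.trans h3).symm)
  exact Filter.EventuallyEq.of_eq (funext fun y => toQuotFun_mul_right_apply hΦ h y)

/-- **Identification of classes**: an `L²` element with a continuous representative `φ` descending `Φ` (`φ [h] = Φ h⁻¹`) IS the
class of `toQuotFun Φ`. [cite: BorelJacquet1979, §4.6] -/
theorem eq_toLp_toQuotFun_of_descent {Φ : 𝒢.Adelic → ℂ} (hΦ : ∀ γ ∈ 𝒢.quotientSubgroup, ∀ g, Φ (γ * g) = Φ g)
    (φ : 𝒢.automorphicQuotient → ℂ) (hφ : ∀ h, φ (𝒢.toAutomorphicQuotient h) = Φ h⁻¹)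
    (f : 𝒢.L2 μ) (hf : (f : 𝒢.automorphicQuotient → ℂ) =ᵐ[μ] φ) (hmem : MemLp (toQuotFun 𝒢 Φ) 2 μ) :
    f = hmem.toLp (toQuotFun 𝒢 Φ) := by
  apply Lp.ext
  rw [descent_eq_toQuotFun hΦ φ hφ] at hf
  exact hf.trans hmem.coeFn_toLp.symm

end ToQuotFun

/-! ## §2 `ContainsForm` unfolded -/

section Contains

variable {K : Type} [Field K] [NumberField K] {𝒢 : AdelicGroupData.{0} K}
  {μ : Measure 𝒢.automorphicQuotient} [SMulInvariantMeasure 𝒢.Adelic 𝒢.automorphicQuotient μ]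

/-- `P.ContainsForm Φ` against GIVEN `MemLp` witnesses of the coordinates: the two coordinate classes lie in `P`
(the `MemLp` proof inside `toLp` is irrelevant). [cite: BorelJacquet1979, §4.6] -/
theorem containsForm_iff_of_memLp (P : DiscreteAutomorphicRep 𝒢 μ) (Φ : 𝒢.Adelic → (Fin 2 → ℂ))
    (hmem : ∀ j : Fin 2, MemLp (toQuotFun 𝒢 fun g => Φ g j) 2 μ) :
    P.ContainsForm Φ ↔ ∀ j : Fin 2, (hmem j).toLp (toQuotFun 𝒢 fun g => Φ g j) ∈ P.space.toSubmodule :=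
  forall_congr' fun j => ⟨fun ⟨_, hh⟩ => hh, fun hh => ⟨hmem j, hh⟩⟩

/-- **`ContainsForm` from classes with continuous descending representatives** (the shape of programme P2's `Represents`,
spelled without that token): if `c j ∈ P` are `L²`-classes a.e. equal to continuous `φ j` with `φ j [h] = Φ h⁻¹ j`, and `Φ` is
left-invariant, then `P.ContainsForm Φ`. [cite: BorelJacquet1979, §4.6] -/
theorem containsForm_of_descents [CompactSpace 𝒢.automorphicQuotient] [IsFiniteMeasure μ] (P : DiscreteAutomorphicRep 𝒢 μ)
    (Φ : 𝒢.Adelic → (Fin 2 → ℂ)) (hleft : ∀ γ ∈ 𝒢.quotientSubgroup, ∀ g, Φ (γ * g) = Φ g)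
    (c : Fin 2 → 𝒢.L2 μ) (hc : ∀ j, c j ∈ P.space.toSubmodule)
    (hφ : ∀ j, ∃ φ : C(𝒢.automorphicQuotient, ℂ), (∀ h, φ (𝒢.toAutomorphicQuotient h) = Φ h⁻¹ j) ∧
      ((c j : 𝒢.automorphicQuotient → ℂ) =ᵐ[μ] ⇑φ)) :
    P.ContainsForm Φ := by
  intro j
  obtain ⟨φ, hφ1, hφ2⟩ := hφ j
  have hleftj : ∀ γ ∈ 𝒢.quotientSubgroup, ∀ g, (fun g => Φ g j) (γ * g) = (fun g => Φ g j) g :=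
    fun γ hγ g => by simp only [hleft γ hγ g]
  have hmem : MemLp (toQuotFun 𝒢 fun g => Φ g j) 2 μ :=
    memLp_toQuotFun hleftj (continuous_of_continuous_descent φ hφ1) 2
  refine ⟨hmem, ?_⟩
  rw [← eq_toLp_toQuotFun_of_descent hleftj φ hφ1 (c j) hφ2 hmem]
  exact hc j

/-- Conversely, under the same descent data, `P.ContainsForm Φ` puts the given classes in `P`. [cite: BorelJacquet1979, §4.6] -/
theorem mem_of_containsForm_of_descents (P : DiscreteAutomorphicRep 𝒢 μ)
    (Φ : 𝒢.Adelic → (Fin 2 → ℂ)) (hleft : ∀ γ ∈ 𝒢.quotientSubgroup, ∀ g, Φ (γ * g) = Φ g)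
    (c : Fin 2 → 𝒢.L2 μ)
    (hφ : ∀ j, ∃ φ : C(𝒢.automorphicQuotient, ℂ), (∀ h, φ (𝒢.toAutomorphicQuotient h) = Φ h⁻¹ j) ∧
      ((c j : 𝒢.automorphicQuotient → ℂ) =ᵐ[μ] ⇑φ))
    (hP : P.ContainsForm Φ) : ∀ j, c j ∈ P.space.toSubmodule := by
  intro j
  obtain ⟨hmem, hmemP⟩ := hP j
  obtain ⟨φ, hφ1, hφ2⟩ := hφ j
  have hleftj : ∀ γ ∈ 𝒢.quotientSubgroup, ∀ g, (fun g => Φ g j) (γ * g) = (fun g => Φ g j) g :=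
    fun γ hγ g => by simp only [hleft γ hγ g]
  rw [eq_toLp_toQuotFun_of_descent hleftj φ hφ1 (c j) hφ2 hmem]
  exact hmemP

end Contains

/-! ## §3 (J3) Equivariant form-valued maps out of an irreducible give a finite component; (J2-shape) Hodge type -/

section FinComponent

variable {F E : Type} [Field F] [NumberField F] [Field E] [NumberField E] [Algebra F E]
  {c : E ≃ₐ[F] E} {N : ℕ} {J : Matrix (Fin N) (Fin N) E}
  {μ : Measure (adelicGroupData F E c N J).automorphicQuotient}

/-- `U(J)` has trivial split component, so `A_G · U(J)(F) = U(J)(F)`: the quotient subgroup of the unitary datum is the image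
of the rational points. [cite: BorelJacquet1979, §4.2] -/
theorem quotientSubgroup_adelicGroupData :
    (adelicGroupData F E c N J).quotientSubgroup = (adelicGroupData F E c N J).toAdelic.range :=
  bot_sup_eq _

/-- Holomorphic cotangent automorphic forms are left-`U(J)(F)`-invariant (first conjunct of ★ `weightForms`).
[cite: BorelJacquet1979, §4.2] -/
theorem leftInvariant_of_mem_holCotForms {ιinf : Literature.Geometry.ComplexHyperbolic.BallModel.U21 →* (adelicGroupData F E c N J).Adelic}
    {Kc : Subgroup (adelicGroupData F E c N J).Adelic} {Φ : (adelicGroupData F E c N J).Adelic → (Fin 2 → ℂ)}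
    (hΦ : Φ ∈ CotangentForms.holCotForms F E c N J ιinf Kc) :
    ∀ γ ∈ (adelicGroupData F E c N J).quotientSubgroup, ∀ g, Φ (γ * g) = Φ g := by
  intro γ hγ g
  rw [quotientSubgroup_adelicGroupData] at hγ
  exact (mem_holCotForms_iff.mp hΦ).1.1 γ hγ g

/-- Cohomological (`(1,0) ⊕ (0,1)`) cotangent automorphic forms are left-`U(J)(F)`-invariant. [cite: BorelJacquet1979, §4.2] -/
theorem leftInvariant_of_mem_cohForms {ιinf : Literature.Geometry.ComplexHyperbolic.BallModel.U21 →* (adelicGroupData F E c N J).Adelic}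
    {Kc : Subgroup (adelicGroupData F E c N J).Adelic} {Φ : (adelicGroupData F E c N J).Adelic → (Fin 2 → ℂ)}
    (hΦ : Φ ∈ CotangentForms.cohForms F E c N J ιinf Kc) :
    ∀ γ ∈ (adelicGroupData F E c N J).quotientSubgroup, ∀ g, Φ (γ * g) = Φ g := by
  intro γ hγ g
  obtain ⟨a, ha, b, hb, rfl⟩ := Submodule.mem_sup.mp hΦ
  obtain ⟨b', hb', rfl⟩ := Submodule.mem_map.mp hb
  simp only [Pi.add_apply, CotangentForms.conjFun_apply, leftInvariant_of_mem_holCotForms ha γ hγ g,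
    leftInvariant_of_mem_holCotForms hb' γ hγ g]

/-- The finite part of `P` on vectors: `(P.finRep g v : L²) = R(1, g) v` (`rfl`). [cite: BorelJacquet1979, §4.6] -/
theorem coe_finRep_apply [SMulInvariantMeasure (adelicGroupData F E c N J).Adelic (adelicGroupData F E c N J).automorphicQuotient μ]
    (P : DiscreteAutomorphicRep (adelicGroupData F E c N J) μ) (g : finAdelic F E c N J) (v : P.space.toSubmodule) :
    ((P.finRep g v : P.space.toSubmodule) : (adelicGroupData F E c N J).L2 μ) =
      (adelicGroupData F E c N J).rightRegular μ (finAdelicToAdelic F E c N J g) (v : (adelicGroupData F E c N J).L2 μ) :=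
  rfl

/-- **J3 — «an irreducible occurring equivariantly among forms contained in `P` is a finite component of `P`».**  Let `P` be a
discrete automorphic representation of `U(J)` (automorphic measure, compact quotient), `σ` an IRREDUCIBLE representation of
`U(J)(𝔸_{F,f})` on `W`, and `ψ : W → (U(J)(𝔸_F) → ℂ²)` a NON-ZERO `ℂ`-linear map, equivariant for right translation
(`ψ (σ g w) = R_g (ψ w)`), whose values are left-`U(J)(F)`-invariant with continuous coordinates and are contained in `P`
(`P.ContainsForm (ψ w)`).  Then `P.HasFinComponent σ`: for a coordinate `j` with `ψ(·)(·) j ≠ 0`, the class map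
`w ↦ [toQuotFun (ψ w · j)] ∈ P` is linear, intertwines `σ` with `P|_{U(J)(𝔸_{F,f})}` (transport identity of §1), is non-zero
(measure positive on open sets), hence injective by Schur for the irreducible `σ`. [cite: BorelJacquet1979, §4.6]
[cite: GelfandGraevPiatetskiShapiro1969, Ch. 1 §2.3] -/
theorem hasFinComponent_of_equivariant [(adelicGroupData F E c N J).IsAutomorphicMeasure μ]
    [CompactSpace (adelicGroupData F E c N J).automorphicQuotient]
    (P : DiscreteAutomorphicRep (adelicGroupData F E c N J) μ)
    {W : Type} [AddCommGroup W] [Module ℂ W] (σ : Representation ℂ (finAdelic F E c N J) W) (hσ : σ.IsIrreducible)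
    (ψ : W →ₗ[ℂ] ((adelicGroupData F E c N J).Adelic → (Fin 2 → ℂ)))
    (hψ : ∀ (g : finAdelic F E c N J) (w : W), ψ (σ g w) = CotangentForms.rightRep F E c N J g (ψ w))
    (hleft : ∀ w, ∀ γ ∈ (adelicGroupData F E c N J).quotientSubgroup, ∀ x, ψ w (γ * x) = ψ w x)
    (hcont : ∀ (w : W) (j : Fin 2), Continuous fun x => ψ w x j)
    (hP : ∀ w, P.ContainsForm (ψ w)) (hne : ψ ≠ 0) :
    P.HasFinComponent σ := by
  haveI := hσ
  -- coordinate functions: left-invariant, continuous, in `L²`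
  have hleftj : ∀ (w : W) (j : Fin 2), ∀ γ ∈ (adelicGroupData F E c N J).quotientSubgroup, ∀ x,
      (fun x => ψ w x j) (γ * x) = (fun x => ψ w x j) x :=
    fun w j γ hγ x => by simp only [hleft w γ hγ x]
  have hmem : ∀ (w : W) (j : Fin 2), MemLp (toQuotFun (adelicGroupData F E c N J) fun x => ψ w x j) 2 μ :=
    fun w j => memLp_toQuotFun (hleftj w j) (hcont w j) 2
  have hmemP : ∀ (w : W) (j : Fin 2),
      (hmem w j).toLp (toQuotFun (adelicGroupData F E c N J) fun x => ψ w x j) ∈ P.space.toSubmodule :=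
    fun w => (containsForm_iff_of_memLp P (ψ w) (hmem w)).mp (hP w)
  -- the coordinate-class maps `L j : W →ₗ[ℂ] P`
  let L : Fin 2 → (W →ₗ[ℂ] P.space.toSubmodule) := fun j =>
    { toFun := fun w => ⟨(hmem w j).toLp (toQuotFun (adelicGroupData F E c N J) fun x => ψ w x j), hmemP w j⟩
      map_add' := fun w w' => by
        apply Subtype.ext
        change (hmem (w + w') j).toLp _ = (hmem w j).toLp _ + (hmem w' j).toLp _
        rw [← MemLp.toLp_add]
        exact MemLp.toLp_congr _ _ (Filter.EventuallyEq.of_eq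
          (funext fun y => by simp only [toQuotFun, map_add, Pi.add_apply]))
      map_smul' := fun r w => by
        apply Subtype.ext
        change (hmem (r • w) j).toLp _ = r • (hmem w j).toLp _
        rw [← MemLp.toLp_const_smul]
        exact MemLp.toLp_congr _ _ (Filter.EventuallyEq.of_eq
          (funext fun y => by simp only [toQuotFun, map_smul, Pi.smul_apply, smul_eq_mul])) }
  have hLcoe : ∀ (j : Fin 2) (w : W), ((L j w : P.space.toSubmodule) : (adelicGroupData F E c N J).L2 μ) =
      (hmem w j).toLp (toQuotFun (adelicGroupData F E c N J) fun x => ψ w x j) := fun _ _ => rfl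
  -- equivariance: the transport identity of §1
  have hint : ∀ (j : Fin 2) (g : finAdelic F E c N J) (w : W), L j (σ g w) = P.finRep g (L j w) := by
    intro j g w
    apply Subtype.ext
    rw [coe_finRep_apply, hLcoe, hLcoe]
    have hfun : (toQuotFun (adelicGroupData F E c N J) fun x => ψ (σ g w) x j) =
        toQuotFun (adelicGroupData F E c N J) fun x => (fun y => ψ w y j) (x * finAdelicToAdelic F E c N J g) := by
      funext y
      simp only [toQuotFun, hψ, CotangentForms.rightRep_apply]
    have hmemh : MemLp (toQuotFun (adelicGroupData F E c N J)
        fun x => (fun y => ψ w y j) (x * finAdelicToAdelic F E c N J g)) 2 μ := hfun ▸ hmem (σ g w) j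
    rw [show (hmem (σ g w) j).toLp _ = hmemh.toLp _ from MemLp.toLp_congr _ _ (Filter.EventuallyEq.of_eq hfun)]
    exact toLp_toQuotFun_mul_right (hleftj w j) _ (hmem w j) hmemh
  -- a coordinate on which `ψ` does not vanish
  obtain ⟨w, hw⟩ : ∃ w, ψ w ≠ 0 := by
    by_contra h
    push Not at h
    exact hne (LinearMap.ext fun w => h w)
  obtain ⟨x, j, hxj⟩ : ∃ (x : (adelicGroupData F E c N J).Adelic) (j : Fin 2), ψ w x j ≠ 0 := by
    by_contra h
    push Not at h
    exact hw (funext fun x => funext fun j => h x j)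
  have hΦne : (fun y => ψ w y j) ≠ 0 := fun h0 => hxj (by simpa using congrFun h0 x)
  have hLne : L j w ≠ 0 := by
    intro h0
    have h1 := congrArg (fun v : P.space.toSubmodule => (v : (adelicGroupData F E c N J).L2 μ)) h0
    simp only [hLcoe, Submodule.coe_zero] at h1
    exact toLp_toQuotFun_ne_zero (hleftj w j) (hcont w j) (hmem w j) hΦne h1
  -- the intertwiner and its injectivity (Schur)
  let f : σ.IntertwiningMap P.finRep := LinearMap.intertwiningMap_of_isIntertwiningMap σ P.finRep (L j) (hint j)
  have hfapply : ∀ w', f w' = L j w' := fun _ => rfl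
  refine ⟨f, (Representation.IsIrreducible.injective_or_eq_zero f).resolve_right ?_⟩
  intro h0
  apply hLne
  rw [← hfapply, h0]
  rfl

variable [SMulInvariantMeasure (adelicGroupData F E c N J).Adelic (adelicGroupData F E c N J).automorphicQuotient μ]

/-- **J2-shape, type `(1,0)`**: a NON-ZERO map `ψ` with values holomorphic cotangent forms contained in `P` exhibits `P` as
H¹-cohomological of Hodge type `(1,0)` (`IsHolCotangentAt`: `∃`-introduction on a `w` with `ψ w ≠ 0`).
[cite: BorelWallach2000, VII 3.2] -/
theorem isHolCotangentAt_of_valued {ιinf : Literature.Geometry.ComplexHyperbolic.BallModel.U21 →* (adelicGroupData F E c N J).Adelic}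
    {Kc : Subgroup (adelicGroupData F E c N J).Adelic} (P : DiscreteAutomorphicRep (adelicGroupData F E c N J) μ)
    {W : Type} (ψ : W → ((adelicGroupData F E c N J).Adelic → (Fin 2 → ℂ)))
    (hvals : ∀ w, ψ w ∈ CotangentForms.holCotForms F E c N J ιinf Kc) (hP : ∀ w, P.ContainsForm (ψ w))
    {w : W} (hw : ψ w ≠ 0) : P.IsHolCotangentAt ιinf Kc :=
  ⟨ψ w, hvals w, hw, hP w⟩

/-- **J2-shape, type `(0,1)`**: the same with values in the conjugates of holomorphic cotangent forms
(`IsAntiholCotangentAt`). [cite: BorelWallach2000, VII 3.2] -/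
theorem isAntiholCotangentAt_of_valued {ιinf : Literature.Geometry.ComplexHyperbolic.BallModel.U21 →* (adelicGroupData F E c N J).Adelic}
    {Kc : Subgroup (adelicGroupData F E c N J).Adelic} (P : DiscreteAutomorphicRep (adelicGroupData F E c N J) μ)
    {W : Type} (ψ : W → ((adelicGroupData F E c N J).Adelic → (Fin 2 → ℂ)))
    (hvals : ∀ w, ψ w ∈ (CotangentForms.holCotForms F E c N J ιinf Kc).map (CotangentForms.conjFun F E c N J))
    (hP : ∀ w, P.ContainsForm (ψ w)) {w : W} (hw : ψ w ≠ 0) : P.IsAntiholCotangentAt ιinf Kc :=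
  ⟨ψ w, hvals w, hw, hP w⟩

end FinComponent

end Summit.HodgeConjecture.HodgeConjecture.Cruxes.H413.SpectrumJunction

end
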